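import Summits.CriticalPhenomena.PercolationContinuityZ3.Theorems.PercNearOneGluingNoHeavyLowerTailQuantitativeKN
import HarnessLib

/-!
# The quantitative Kozma–Nitzan inequality for the SECOND-BEST relay (rank-2 Q-KN)

Support file (`--supports stmt-CriticalPhenomena-4575`), prover `prim-ineq-gen-6` (gen 11; memo `prim-ineq-gen-6/FINDING-G11.md` §1).
No definitions, no named facts, no sorries; standard axioms.

Kozma–Nitzan's Conjecture 4 / Question 7 (tree theorems `PreFKGSurplus.kn_conj4_holds`, `Q7Psi.kn_conj4_designated`) and the lineage's
quantitative form Q-KN (`PreFKGSurplus.quantitative_kn_conj4_holds`, gen 9) designate a relay `c ∈ A` of LEAST mean `m_c = E F(C(c))`.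
THIS FILE removes the minimality at ONE relay: for every monotone cluster property `F`, every relay set `A`, observer `o ∉ A`, and every pair
of distinct relays `c, k ∈ A` such that `m_c ≤ m_a` for all `a ∈ A ∖ {k}` — i.e. `c` is a least-mean relay of `A ∖ {k}`, AT MOST ONE relay
(`k`) having a smaller mean — the quantitative inequality holds VERBATIM:

  `E[(F(C(o)) − F(C(c))); o ↔ A]  ≥  Σ_{a ∈ A∖c} (m_a − m_c) · φ_a`,   `φ_a := μ(o ↔ a | a ↮ A∖a)`      (`quantitative_kn_rank2_holds`),

where now the term of `k` may be negative.  In particular (`F = 1{b ∈ ·}`, `quantitativeKN_rank2_holds`): for the SECOND most detached relay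
`c` (one relay `k` with `P(k ↔ b) < P(c ↔ b)` allowed),
  `P(o ↔ b, o ↔ A) − P(c ↔ b, o ↔ A) ≥ Σ_{a ≠ c} φ_a · (P(a ↔ b) − P(c ↔ b))`,
so Kozma–Nitzan's pre-FKG inequality `(3)` holds for the runner-up `c` as soon as `φ_k (P(c↔b) − P(k↔b)) ≤ Σ_{a ≠ c,k} φ_a (P(a↔b) − P(c↔b))`
(`preFKG_of_rank2_balance`).  For three or more relays below `c` the displayed bound is FALSE (exact census of the cell memo: 0 violations in
192,268 instances with at most one better relay, n ≤ 6 exhaustive graphs; 40,251 / 107,208 violations with two better relays).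
PROOF.  Gen 9's proof of Q-KN peels ONE relay with the van den Berg–Häggström–Kahn positive association and then runs the conditioned-slack-hierarchy
margin induction (`PreFKGSurplus.preMargin_ge_sum_of_csh`) on the remaining relays; the peeling step uses no sign information, and the margin
induction needs the minimality of `c` only among the relays it treats.  Peeling exactly the exceptional relay `k` first gives the theorem; the
coefficient of `k` is `μ(o ↔ k | k ↮ A∖k) = φ_k` on the nose.
[cite: KozmaNitzan2024, Conj. 4 (p. 32), Conj. 2 / display (3) (p. 3), Question 7 (p. 36), Lemma 2 (p. 6)]
[cite: VandenbergHaggstromKahn2005, Thm. 1.3 (p. 6), §2.1 Lemma 2.4 (p. 10)]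
-/

noncomputable section

namespace Summit.CriticalPhenomena.PercolationContinuityZ3.Theorems

open MeasureTheory Set Literature.Probability.LatticeModels Literature.Probability.Percolation
open scoped Classical
open KNPreFKG CSH

namespace PreFKGSurplus

variable {n : ℕ}

/-- **Rank-2 Q-KN from the conditioned slack hierarchy.**  Non-degenerate weights, `hCSH` = prim-hp-8's Theorem 1 (as in
`quantitative_kn_conj4_of_csh`).  For every relay set `A`, observer `o ∉ A`, monotone `F`, and distinct relays `c, k ∈ A` with
`m_c ≤ m_a` for every `a ∈ A ∖ {k}` (nothing is assumed about `m_k`):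
`Σ_{a ∈ A∖c} (m_a − m_c) · μ(o ↔ a | a ↮ A∖a) ≤ E[F(C(o)); o ↔ A] − E[F(C(c)); o ↔ A]`.
Proof: gen 9's proof of `quantitative_kn_conj4_of_csh` with the exceptional relay `k` peeled first (vdBHK Thm 1.3), then the
quantitative two-observer margin `preMargin_ge_sum_of_csh` on `A ∖ {k}`, where `c` IS of least mean.
[cite: KozmaNitzan2024, Conj. 4 (p. 32), Question 7 (p. 36), Lemma 2 (p. 6)] [cite: VandenbergHaggstromKahn2005, Thm. 1.3 (p. 6)] -/
theorem quantitative_kn_rank2_of_csh (w : Sym2 (Fin n) → unitInterval) (hw : ∀ e, 0 < w e ∧ w e < 1)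
    (hCSH : ∀ (o v x : Fin n) (Y : Finset (Fin n)) (D : List (Fin n)),
      o ≠ v → x ∉ Y → o ≠ x → v ≠ x → o ∉ Y → v ∉ Y → D.Nodup → (∀ d ∈ D, d ≠ x ∧ d ∉ Y ∧ d ≠ o ∧ d ≠ v) →
      CSHHolds w x (↑Y : Set (Fin n)) D o v)
    (A : Finset (Fin n)) (o c k : Fin n) (F : Set (Fin n) → ℝ) (hF : ∀ S T : Set (Fin n), S ⊆ T → F S ≤ F T)
    (hcA : c ∈ A) (hoA : o ∉ A) (hkA : k ∈ A) (hkc : k ≠ c)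
    (hcmin : ∀ a ∈ A.erase k, ∫ ω, F (openCluster ω c) ∂(prodBernoulli w) ≤ ∫ ω, F (openCluster ω a) ∂(prodBernoulli w)) :
    ∑ a ∈ A.erase c, ((∫ ω, F (openCluster ω a) ∂(prodBernoulli w)) - ∫ ω, F (openCluster ω c) ∂(prodBernoulli w)) *
        avoidConst w a (↑(A.erase a) : Set (Fin n)) o ≤
      ∫ ω in ⋃ a' ∈ A, openConn o a', (F (openCluster ω o) - F (openCluster ω c)) ∂(prodBernoulli w) := by
  classical
  set μ := prodBernoulli w with hμ
  have hmeas : ∀ S : Set (BondConfig (Fin n)), MeasurableSet S := fun _ => MeasurableSet.of_discrete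
  have hint : ∀ (g : BondConfig (Fin n) → ℝ), Integrable g μ := fun g => Integrable.of_finite
  set δ : Fin n → ℝ := fun a => (∫ ω, F (openCluster ω a) ∂μ) - ∫ ω, F (openCluster ω c) ∂μ with hδ
  have hk : k ∈ A.erase c := Finset.mem_erase.2 ⟨hkc, hkA⟩
  set X' : Finset (Fin n) := A.erase k with hX'
  have hX'A : ∀ a ∈ X', a ∈ A := fun a ha => Finset.mem_of_mem_erase ha
  have hkX' : k ∉ X' := Finset.notMem_erase k A
  have hcX' : c ∈ X' := Finset.mem_erase.2 ⟨hkc.symm, hcA⟩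
  have hko : o ≠ k := fun h => hoA (h ▸ hkA)
  have hoX' : o ∉ X' := fun h => hoA (hX'A o h)
  set Dk : Set (BondConfig (Fin n)) := {ω : BondConfig (Fin n) | ∀ a ∈ (↑X' : Set (Fin n)), ¬ (openGraph ω).Reachable k a}
    with hDk
  set gk : BondConfig (Fin n) → ℝ := fun ω => F (openCluster ω k) - F (openCluster ω c) with hgk
  set Gk : Set (Sym2 (Fin n)) → ℝ := fun K => F {z | z = k ∨ ∃ e ∈ K, z ∈ e} -
    ∫ η, F (openCluster (η \ BHK2006.barOf {k} K) c) ∂μ with hGk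
  have hGk_mono : Monotone Gk := CovTau.monotone_projFun w c k F hF
  set Δo : ℝ := ∫ ω in ⋃ a' ∈ X', openConn o a', (F (openCluster ω o) - F (openCluster ω c)) ∂μ with hΔo
  set Δk : ℝ := ∫ ω in ⋃ a' ∈ X', openConn k a', (F (openCluster ω k) - F (openCluster ω c)) ∂μ with hΔk
  set Tko : ℝ := ∫ ω in Dk ∩ openConn k o, gk ω ∂μ with hTko
  set J : ℝ := ∫ ω in Dk, gk ω ∂μ with hJ
  set M : ℝ := μ.real Dk with hM
  set E : ℝ := μ.real (Dk ∩ openConn k o) with hE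
  set S' : ℝ := ∑ a ∈ X'.erase c, δ a * avoidConst w a (↑(A.erase a) : Set (Fin n)) o with hS'
  -- peel
  have hpeel : ∫ ω in ⋃ a' ∈ A, openConn o a', (F (openCluster ω o) - F (openCluster ω c)) ∂μ = Δo + Tko := by
    rw [hΔo, hTko, hgk]
    exact preSurplus_erase_add w A F c k o hkA
  -- tower identities
  have hDk_S : ∀ u : Fin n, Dk ∩ openConn k u =
      {ω : BondConfig (Fin n) | ¬ (openGraph ω).Reachable k c} ∩
        {ω | openEdgeCluster ω k ∈ {K : Set (Sym2 (Fin n)) |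
          (∀ a ∈ X', a ≠ c → ¬ (a = k ∨ ∃ e ∈ K, a ∈ e)) ∧ (u = k ∨ ∃ e ∈ K, u ∈ e)}} := by
    intro u; ext ω
    simp only [mem_inter_iff, hDk, mem_setOf_eq, Finset.mem_coe]
    constructor
    · rintro ⟨h1, h2⟩
      refine ⟨h1 c hcX', fun a ha _ => ?_, (reachable_iff_exists_mem_openEdgeCluster ω k u).1 h2⟩
      rw [← reachable_iff_exists_mem_openEdgeCluster]; exact h1 a ha
    · rintro ⟨h1, h2, h3⟩
      refine ⟨fun a ha => ?_, (reachable_iff_exists_mem_openEdgeCluster ω k u).2 h3⟩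
      by_cases hac : a = c
      · rw [hac]; exact h1
      · rw [reachable_iff_exists_mem_openEdgeCluster]; exact h2 a ha hac
  have hDk_0 : Dk = {ω : BondConfig (Fin n) | ¬ (openGraph ω).Reachable k c} ∩
        {ω | openEdgeCluster ω k ∈ {K : Set (Sym2 (Fin n)) | ∀ a ∈ X', a ≠ c → ¬ (a = k ∨ ∃ e ∈ K, a ∈ e)}} := by
    ext ω
    simp only [mem_inter_iff, hDk, mem_setOf_eq, Finset.mem_coe]
    constructor
    · intro h1
      refine ⟨h1 c hcX', fun a ha _ => ?_⟩
      rw [← reachable_iff_exists_mem_openEdgeCluster]; exact h1 a ha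
    · rintro ⟨h1, h2⟩ a ha
      by_cases hac : a = c
      · rw [hac]; exact h1
      · rw [reachable_iff_exists_mem_openEdgeCluster]; exact h2 a ha hac
  have towO : Tko = ∫ ω in Dk ∩ openConn k o, Gk (openEdgeCluster ω k) ∂μ := by
    simp only [hTko, hgk]; rw [hDk_S o]; exact CovTau.setIntegral_sub_eq_projFun w c k F _
  have tow0 : J = ∫ ω in Dk, Gk (openEdgeCluster ω k) ∂μ := by
    simp only [hJ, hgk]; rw [hDk_0]; exact CovTau.setIntegral_sub_eq_projFun w c k F _
  have hJtot : J = δ k - Δk := by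
    have h1 := integral_add_compl (hmeas Dk) (hint gk)
    have hDkc : Dkᶜ = ⋃ a' ∈ X', (openConn k a' : Set (BondConfig (Fin n))) := by
      ext ω
      rw [mem_iUnion_openConn, mem_compl_iff, hDk]
      simp only [mem_setOf_eq, Finset.mem_coe, not_forall, not_not, exists_prop]
    have h2 : ∫ ω in Dkᶜ, gk ω ∂μ = Δk := by
      rw [hDkc]
    have h3 : ∫ ω, gk ω ∂μ = δ k := by
      rw [hgk, integral_sub (hint _) (hint _)]
    rw [hJ]; linarith
  -- one-cluster positive association for `C_k` given `k ↮ X'`:  `M·Tko ≥ J·E`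
  have hG : Monotone ((connFamily k o).indicator (1 : Set (Sym2 (Fin n)) → ℝ)) :=
    monotone_indicator_one_of_isUpperSet (isUpperSet_connFamily k o)
  have hPA := BHK2006_clusterConditionalPositiveAssociation_holds (Fin n) w k (↑X' : Set (Fin n)) Gk
    ((connFamily k o).indicator 1) hGk_mono hG (by exact_mod_cast hkX')
  have hind : (fun ω : BondConfig (Fin n) => (connFamily k o).indicator (1 : Set (Sym2 (Fin n)) → ℝ) (openEdgeCluster ω k)) =
      (openConn k o : Set (BondConfig (Fin n))).indicator 1 := by
    rw [indicator_comp_openEdgeCluster (connFamily k o) k, ← openConn_eq_setOf_connFamily]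
  have hI1 : ∫ ω in Dk, (connFamily k o).indicator (1 : Set (Sym2 (Fin n)) → ℝ) (openEdgeCluster ω k) ∂μ = E := by
    rw [show (fun ω => (connFamily k o).indicator (1 : Set (Sym2 (Fin n)) → ℝ) (openEdgeCluster ω k)) =
      (openConn k o : Set (BondConfig (Fin n))).indicator 1 from hind, setIntegral_indicator_one_eq]
  have hI2 : ∫ ω in Dk, Gk (openEdgeCluster ω k) * (connFamily k o).indicator (1 : Set (Sym2 (Fin n)) → ℝ) (openEdgeCluster ω k) ∂μ =
      ∫ ω in Dk ∩ openConn k o, Gk (openEdgeCluster ω k) ∂μ := by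
    have e : ∀ ω : BondConfig (Fin n), Gk (openEdgeCluster ω k) *
        (connFamily k o).indicator (1 : Set (Sym2 (Fin n)) → ℝ) (openEdgeCluster ω k) =
        Gk (openEdgeCluster ω k) * (openConn k o : Set (BondConfig (Fin n))).indicator (1 : BondConfig (Fin n) → ℝ) ω :=
      fun ω => congrArg (fun t => Gk (openEdgeCluster ω k) * t) (congrFun hind ω)
    simp_rw [e]
    exact setIntegral_mul_indicator_one μ Dk (openConn k o) _
  have hC : J * E ≤ M * Tko := by
    have h := hPA
    rw [hI1, hI2, ← tow0, ← towO] at h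
    rw [hM]
    linarith [h]
  -- the QUANTITATIVE two-observer margin at `D = []`, observers `(o, k)`
  have hpm := preMargin_ge_sum_of_csh w hw o k
    (fun x Y D hxY hox hkx hoY hkY hD hDd => hCSH o k x Y D hko hxY hox hkx hoY hkY hD hDd)
    X' c [] F hF hcX' (fun a ha => hcmin a ha) hoX' hkX' List.nodup_nil
    (fun d hd => by simp at hd)
  simp only [decoyList, cshMarg_nil] at hpm
  have hset0 : ((↑X' : Set (Fin n)) ∪ {d | d ∈ ([] : List (Fin n))}) = ↑X' := by simp
  have hp0 : obsConst w o k ((↑X' : Set (Fin n)) ∪ {d | d ∈ ([] : List (Fin n))}) = E / M := by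
    rw [hset0, obsConst, hE, hM, hDk, openConn_symm o k]
  rw [hp0] at hpm
  -- the coefficients of the margin are the `φ_a` of `A`
  have hcoef : ∀ a ∈ X'.erase c,
      avoidConst w a ((((↑X' : Set (Fin n)) ∪ {d | d ∈ ([] : List (Fin n))}) ∪ {k}) \ {a}) o =
        avoidConst w a (↑(A.erase a) : Set (Fin n)) o := by
    intro a ha
    have hak : a ≠ k := fun h => hkX' (h ▸ Finset.mem_of_mem_erase ha)
    congr 1
    ext z
    simp only [hX', Finset.coe_erase, mem_sdiff, mem_union, mem_setOf_eq, List.not_mem_nil, mem_singleton_iff, Finset.mem_coe,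
      or_false]
    constructor
    · rintro ⟨(⟨hz, _⟩ | rfl), hza⟩
      · exact ⟨hz, hza⟩
      · exact ⟨hkA, hza⟩
    · rintro ⟨hz, hza⟩
      by_cases hzk : z = k
      · exact ⟨Or.inr hzk, hza⟩
      · exact ⟨Or.inl ⟨hz, hzk⟩, hza⟩
  rw [Finset.sum_congr rfl (fun a ha => by rw [hcoef a ha])] at hpm
  -- hpm : S' ≤ Δo − (E/M)·Δk
  have hMpos : 0 < M := by
    refine prodBernoulli_real_pos_of_nonempty hw ⟨∅, ?_⟩
    intro a ha h
    rw [HullPort.reachable_empty_iff] at h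
    exact hkX' (h ▸ (Finset.mem_coe.1 ha))
  have hE0 : 0 ≤ E := measureReal_nonneg
  have hpm' : M * S' ≤ M * Δo - E * Δk := by
    have : M * S' ≤ M * (Δo - E / M * Δk) := mul_le_mul_of_nonneg_left hpm hMpos.le
    have e : M * (Δo - E / M * Δk) = M * Δo - E * Δk := by field_simp
    linarith [this, e]
  -- the detachment coefficient of the peeled relay: `φ_k = E / M`
  have hφk : avoidConst w k (↑(A.erase k) : Set (Fin n)) o = E / M := by
    rw [avoidConst, hE, hM, hDk, hX']
  -- split the sum at `k` and assemble
  have hsum : ∑ a ∈ A.erase c, δ a * avoidConst w a (↑(A.erase a) : Set (Fin n)) o = δ k * (E / M) + S' := by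
    rw [hS', hX', Finset.erase_right_comm, ← hφk]
    exact (Finset.add_sum_erase (A.erase c) (fun a => δ a * avoidConst w a (↑(A.erase a) : Set (Fin n)) o) hk).symm
  have hfin : M * (δ k * (E / M) + S') ≤ M * (Δo + Tko) := by
    have e1 : M * (δ k * (E / M) + S') = δ k * E + M * S' := by field_simp
    have hJE : J * E = δ k * E - Δk * E := by rw [hJtot]; ring
    nlinarith [hC, hpm', hJE, e1]
  show ∑ a ∈ A.erase c, δ a * avoidConst w a (↑(A.erase a) : Set (Fin n)) o ≤ _
  rw [hsum, hpeel]
  exact le_of_mul_le_mul_left hfin hMpos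

/-- **Rank-2 Q-KN, unconditionally** (finite graph `Fin n`, non-degenerate weights): `quantitative_kn_rank2_of_csh` with prim-hp-8's Theorem 1
`CSH.cshAll`.  For `o ∉ A`, distinct `c, k ∈ A` with `m_c ≤ m_a` for all `a ∈ A ∖ {k}`:
`Σ_{a ∈ A∖c} (m_a − m_c)·μ(o ↔ a | a ↮ A∖a) ≤ E[(F(C(o)) − F(C(c))); o ↔ A]`. [cite: KozmaNitzan2024, Conj. 4 (p. 32), Question 7 (p. 36)] -/
theorem quantitative_kn_rank2_holds (w : Sym2 (Fin n) → unitInterval) (hw : ∀ e, 0 < w e ∧ w e < 1)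
    (A : Finset (Fin n)) (o c k : Fin n) (F : Set (Fin n) → ℝ) (hF : ∀ S T : Set (Fin n), S ⊆ T → F S ≤ F T)
    (hcA : c ∈ A) (hoA : o ∉ A) (hkA : k ∈ A) (hkc : k ≠ c)
    (hcmin : ∀ a ∈ A.erase k, ∫ ω, F (openCluster ω c) ∂(prodBernoulli w) ≤ ∫ ω, F (openCluster ω a) ∂(prodBernoulli w)) :
    ∑ a ∈ A.erase c, ((∫ ω, F (openCluster ω a) ∂(prodBernoulli w)) - ∫ ω, F (openCluster ω c) ∂(prodBernoulli w)) *
        avoidConst w a (↑(A.erase a) : Set (Fin n)) o ≤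
      ∫ ω in ⋃ a' ∈ A, openConn o a', (F (openCluster ω o) - F (openCluster ω c)) ∂(prodBernoulli w) :=
  quantitative_kn_rank2_of_csh w hw (CSH.cshAll n w hw) A o c k F hF hcA hoA hkA hkc hcmin

/-- **Rank-2 Q-KN for the connection indicator** (`F = 1{b ∈ ·}`): on every finite graph with non-degenerate weights, for every relay set `A`,
target `b`, observer `o ∉ A`, and distinct relays `c, k ∈ A` with `P(c ↔ b) ≤ P(a ↔ b)` for all `a ∈ A ∖ {k}` (the runner-up `c` of the
detachment order, `k` the possibly better-connected relay):
`Σ_{a ∈ A∖c} φ_a · (P(a ↔ b) − P(c ↔ b)) ≤ P(o ↔ b, o ↔ A) − P(c ↔ b, o ↔ A)`,  `φ_a = P(o ↔ a | a ↮ A∖a)`.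
[cite: KozmaNitzan2024, Conj. 2 / display (3) (p. 3), Question 7 (p. 36), Lemma 2 (p. 6)] -/
theorem quantitativeKN_rank2_holds (w : Sym2 (Fin n) → unitInterval) (hw : ∀ e, 0 < w e ∧ w e < 1)
    (A : Finset (Fin n)) (o b c k : Fin n) (hcA : c ∈ A) (hoA : o ∉ A) (hkA : k ∈ A) (hkc : k ≠ c)
    (hcmin : ∀ a ∈ A.erase k, (prodBernoulli w).real (openConn c b) ≤ (prodBernoulli w).real (openConn a b)) :
    ∑ a ∈ A.erase c, ((prodBernoulli w).real (openConn a b) - (prodBernoulli w).real (openConn c b)) *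
        avoidConst w a (↑(A.erase a) : Set (Fin n)) o ≤
      (prodBernoulli w).real (openConn o b ∩ ⋃ a' ∈ A, openConn o a') -
        (prodBernoulli w).real (openConn c b ∩ ⋃ a' ∈ A, openConn o a') := by
  classical
  have hmeas : ∀ S : Set (BondConfig (Fin n)), MeasurableSet S := fun _ => MeasurableSet.of_discrete
  have hint : ∀ (g : BondConfig (Fin n) → ℝ), Integrable g (prodBernoulli w) := fun g => Integrable.of_finite
  have hF : ∀ S T : Set (Fin n), S ⊆ T →
      (fun S : Set (Fin n) => if b ∈ S then (1 : ℝ) else 0) S ≤ (fun S : Set (Fin n) => if b ∈ S then (1 : ℝ) else 0) T := by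
    intro S T hST
    by_cases hS : b ∈ S
    · simp [hS, hST hS]
    · by_cases hT : b ∈ T
      · simp [hS, hT]
      · simp [hS, hT]
  have e : ∀ x : Fin n, (fun ω : BondConfig (Fin n) => if b ∈ openCluster ω x then (1 : ℝ) else 0) =
      (openConn x b : Set (BondConfig (Fin n))).indicator 1 := by
    intro x; funext ω
    by_cases hω : ω ∈ openConn x b
    · rw [Set.indicator_of_mem hω, Pi.one_apply]; exact if_pos (show b ∈ openCluster ω x from hω)
    · rw [Set.indicator_of_notMem hω]; exact if_neg (show b ∉ openCluster ω x from hω)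
  have e1 : ∀ x : Fin n, ∫ ω, (if b ∈ openCluster ω x then (1 : ℝ) else 0) ∂(prodBernoulli w) =
      (prodBernoulli w).real (openConn x b) := by
    intro x
    rw [e x, integral_indicator_one (hmeas _)]
  have e2 : ∀ x : Fin n, ∫ ω in ⋃ a' ∈ A, openConn o a', (if b ∈ openCluster ω x then (1 : ℝ) else 0) ∂(prodBernoulli w) =
      (prodBernoulli w).real (openConn x b ∩ ⋃ a' ∈ A, openConn o a') := by
    intro x
    rw [e x, integral_indicator_one (hmeas _), measureReal_restrict_apply (hmeas _)]
  have h := quantitative_kn_rank2_holds w hw A o c k (fun S : Set (Fin n) => if b ∈ S then (1 : ℝ) else 0) hF hcA hoA hkA hkc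
    (fun a ha => by rw [e1, e1]; exact hcmin a ha)
  rw [integral_sub (hint _).integrableOn (hint _).integrableOn, e2, e2] at h
  simp only [e1] at h
  exact h

/-- **Kozma–Nitzan's pre-FKG inequality `(3)` for the runner-up relay under a balance condition**: with `o ∉ A`, distinct `c, k ∈ A`,
`P(c ↔ b) ≤ P(a ↔ b)` for all `a ∈ A ∖ {k}`, and
`φ_k · (P(c ↔ b) − P(k ↔ b)) ≤ Σ_{a ∈ A∖{c,k}} φ_a · (P(a ↔ b) − P(c ↔ b))`  (`φ_a = P(o ↔ a | a ↮ A∖a)`),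
one has `P(c ↔ b, o ↔ A) ≤ P(o ↔ b, o ↔ A)`.  (For `k` of smaller mean than `c` this is a case of display (3) NOT covered by Question 7.)
[cite: KozmaNitzan2024, Conj. 2 / display (3) (p. 3), Question 7 (p. 36)] -/
theorem preFKG_of_rank2_balance (w : Sym2 (Fin n) → unitInterval) (hw : ∀ e, 0 < w e ∧ w e < 1)
    (A : Finset (Fin n)) (o b c k : Fin n) (hcA : c ∈ A) (hoA : o ∉ A) (hkA : k ∈ A) (hkc : k ≠ c)
    (hcmin : ∀ a ∈ A.erase k, (prodBernoulli w).real (openConn c b) ≤ (prodBernoulli w).real (openConn a b))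
    (hbal : avoidConst w k (↑(A.erase k) : Set (Fin n)) o *
        ((prodBernoulli w).real (openConn c b) - (prodBernoulli w).real (openConn k b)) ≤
      ∑ a ∈ (A.erase c).erase k, ((prodBernoulli w).real (openConn a b) - (prodBernoulli w).real (openConn c b)) *
        avoidConst w a (↑(A.erase a) : Set (Fin n)) o) :
    (prodBernoulli w).real (openConn c b ∩ ⋃ a' ∈ A, openConn o a') ≤
      (prodBernoulli w).real (openConn o b ∩ ⋃ a' ∈ A, openConn o a') := by
  have h := quantitativeKN_rank2_holds w hw A o b c k hcA hoA hkA hkc hcmin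
  have hk : k ∈ A.erase c := Finset.mem_erase.2 ⟨hkc, hkA⟩
  rw [← Finset.add_sum_erase (A.erase c) _ hk] at h
  nlinarith [h, hbal]

end PreFKGSurplus

end Summit.CriticalPhenomena.PercolationContinuityZ3.Theorems

end
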